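import Mathlib

/-!
# Relations between two rational `p`-units (solo-ABC-informed, s8)

Sharpest-statement artefact for `Summit.ABC` (family `abc`, soloist `solo-ABC-informed`), the
arithmetic half of *Theorem E* (floor of the two-logarithm method, `SoloInformedTwoLogFloor.lean`).
For multiplicatively independent `p`-units `α₁, α₂ ∈ ℚˣ` with reductions `u₁, u₂ ∈ 𝔽_pˣ` the
*relation lattice* is `Λ = {(m, n) ∈ ℤ² : u₁^m u₂^n = 1}`.  This file proves the two facts about
`Λ` that drive Theorem E:

* `soloInformed_liouville_relation` (Liouville): a non-trivial relation costs height,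
  `log p - log 2 ≤ |m|·log H(α₁) + |n|·log H(α₂)`, because `α₁^m α₂^n - 1 ≠ 0` is a rational
  number whose numerator (in the obvious integral representation `soloInformed_punit_zpow_repr`)
  is divisible by `p` and bounded by `2 H(α₁)^{|m|} H(α₂)^{|n|}`;
* `soloInformed_card_closure_dvd_det` (index): every `2 × 2` determinant of relations is
  divisible by `g = |⟨u₁, u₂⟩|` (valid in any commutative cyclic group; `𝔽_pˣ` is cyclic);

together with the elementary optimisation `soloInformed_floor_endgame` used at the end of the
proof of Theorem E.  References: folklore (Liouville inequality); paper.md §2.2(i).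
-/

open Finset Real

namespace Summit.ABC.ABC.Theorems

/-- In a commutative cyclic group: two relations `u₁^m u₂^n = 1`, `u₁^{m'} u₂^{n'} = 1` have
determinant divisible by the order of `⟨u₁, u₂⟩`. [folklore] -/
theorem soloInformed_card_closure_dvd_det {G : Type*} [CommGroup G] [IsCyclic G]
    (u₁ u₂ : G) {m n m' n' : ℤ} (h : u₁ ^ m * u₂ ^ n = 1) (h' : u₁ ^ m' * u₂ ^ n' = 1) :
    (Nat.card (Subgroup.closure ({u₁, u₂} : Set G)) : ℤ) ∣ m * n' - n * m' := by
  set H := Subgroup.closure ({u₁, u₂} : Set G) with hH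
  obtain ⟨γ, hγ⟩ := IsCyclic.exists_generator (α := H)
  have hN : orderOf (γ : G) = Nat.card H := by
    rw [Subgroup.orderOf_coe, orderOf_eq_card_of_forall_mem_zpowers hγ]
  have hu₁H : u₁ ∈ H := Subgroup.subset_closure (by simp)
  have hu₂H : u₂ ∈ H := Subgroup.subset_closure (by simp)
  obtain ⟨a, ha⟩ := Subgroup.mem_zpowers_iff.mp (hγ ⟨u₁, hu₁H⟩)
  obtain ⟨b, hb⟩ := Subgroup.mem_zpowers_iff.mp (hγ ⟨u₂, hu₂H⟩)
  have ha' : (γ : G) ^ a = u₁ := by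
    have := congrArg Subtype.val ha
    simpa using this
  have hb' : (γ : G) ^ b = u₂ := by
    have := congrArg Subtype.val hb
    simpa using this
  obtain ⟨x, y, hxy⟩ := Subgroup.mem_closure_pair.mp γ.2
  have r1 : (γ : G) ^ (a * m + b * n) = 1 := by
    rw [zpow_add, zpow_mul, zpow_mul, ha', hb']; exact h
  have r2 : (γ : G) ^ (a * m' + b * n') = 1 := by
    rw [zpow_add, zpow_mul, zpow_mul, ha', hb']; exact h'
  have r3 : (γ : G) ^ (a * x + b * y - 1) = 1 := by
    rw [zpow_sub, zpow_one, zpow_add, zpow_mul, zpow_mul, ha', hb', hxy, mul_inv_cancel]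
  rw [← orderOf_dvd_iff_zpow_eq_one, hN] at r1 r2 r3
  have d1 : (Nat.card H : ℤ) ∣ a * (m * n' - n * m') := by
    have e : a * (m * n' - n * m') = (a * m + b * n) * n' - (a * m' + b * n') * n := by ring
    rw [e]; exact dvd_sub (dvd_mul_of_dvd_left r1 _) (dvd_mul_of_dvd_left r2 _)
  have d2 : (Nat.card H : ℤ) ∣ b * (m * n' - n * m') := by
    have e : b * (m * n' - n * m') = (a * m' + b * n') * m - (a * m + b * n) * m' := by ring
    rw [e]; exact dvd_sub (dvd_mul_of_dvd_left r2 _) (dvd_mul_of_dvd_left r1 _)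
  have e : m * n' - n * m' = x * (a * (m * n' - n * m')) + y * (b * (m * n' - n * m'))
      - (a * x + b * y - 1) * (m * n' - n * m') := by ring
  rw [e]
  exact dvd_sub (dvd_add (dvd_mul_of_dvd_right d1 _) (dvd_mul_of_dvd_right d2 _))
    (dvd_mul_of_dvd_left r3 _)

/-- A rational number other than `0, ±1` has naive height at least `2`. [folklore] -/
theorem soloInformed_two_le_height (α : ℚ) (h0 : α ≠ 0) (h1 : α ≠ 1) (hm1 : α ≠ -1) :
    2 ≤ max α.num.natAbs α.den := by
  by_contra hcon
  push Not at hcon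
  have hd1 := le_max_right α.num.natAbs α.den
  have hn1 := le_max_left α.num.natAbs α.den
  have hdpos := α.den_pos
  have hden : α.den = 1 := by omega
  have hαnum : (α.num : ℚ) = α := Rat.coe_int_num_of_den_eq_one hden
  have hcases : α.num = 0 ∨ α.num = 1 ∨ α.num = -1 := by omega
  rcases hcases with h | h | h
  · exact h0 (by rw [← hαnum, h]; simp)
  · exact h1 (by rw [← hαnum, h]; simp)
  · exact hm1 (by rw [← hαnum, h]; simp)

section PUnits

variable {p : ℕ} [hp : Fact p.Prime]

/-- A rational `p`-unit has numerator and denominator prime to `p`. [folklore] -/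
theorem soloInformed_punit_num_den (α : ℚ) (hα : α ≠ 0) (hv : padicValRat p α = 0) :
    ¬ (p : ℤ) ∣ α.num ∧ ¬ p ∣ α.den := by
  have hcop : Nat.Coprime α.num.natAbs α.den := α.reduced
  have hpp : p.Prime := hp.out
  have hnum0 : α.num ≠ 0 := Rat.num_ne_zero.mpr hα
  rw [padicValRat_def] at hv
  by_cases hn : (p : ℤ) ∣ α.num
  · have hnd : ¬ p ∣ α.den := by
      intro hd
      have h1 : p ∣ α.num.natAbs := Int.natCast_dvd.mp hn
      have h2 : p ∣ Nat.gcd α.num.natAbs α.den := Nat.dvd_gcd h1 hd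
      rw [Nat.Coprime.gcd_eq_one hcop] at h2
      exact hpp.one_lt.ne' (Nat.dvd_one.mp h2)
    exfalso
    have h1 : (1 : ℤ) ≤ padicValInt p α.num := by
      have := (padicValInt_dvd_iff 1 α.num).mp (by simpa using hn)
      rcases this with h | h
      · exact absurd h hnum0
      · exact_mod_cast h
    have h2 : padicValNat p α.den = 0 := padicValNat.eq_zero_of_not_dvd hnd
    rw [h2] at hv
    push_cast at hv
    omega
  · refine ⟨hn, fun hd => ?_⟩
    have h1 : padicValInt p α.num = 0 := padicValInt.eq_zero_of_not_dvd hn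
    have h2 : 1 ≤ padicValNat p α.den := one_le_padicValNat_of_dvd α.den_ne_zero hd
    rw [h1] at hv
    omega

/-- Integral representation of `α^e` for a rational `p`-unit `α`: `α^e = U/V` with `p ∤ V`,
the same identity in `ZMod p`, and `|U|, |V| ≤ H(α)^{|e|}`. [folklore] -/
theorem soloInformed_punit_zpow_repr (α : ℚ) (hα : α ≠ 0) (hv : padicValRat p α = 0) (e : ℤ) :
    ∃ U V : ℤ, V ≠ 0 ∧ ¬ (p : ℤ) ∣ V ∧ α ^ e = (U : ℚ) / V ∧
      (α : ZMod p) ^ e = (U : ZMod p) / (V : ZMod p) ∧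
      U.natAbs ≤ (max α.num.natAbs α.den) ^ e.natAbs ∧
      V.natAbs ≤ (max α.num.natAbs α.den) ^ e.natAbs := by
  obtain ⟨hn, hd⟩ := soloInformed_punit_num_den α hα hv
  have hnum0 : α.num ≠ 0 := Rat.num_ne_zero.mpr hα
  have hden0 : (α.den : ℤ) ≠ 0 := by exact_mod_cast α.den_ne_zero
  have hpp : Prime (p : ℤ) := Nat.prime_iff_prime_int.mp hp.out
  have hαq : (α.num : ℚ) / (α.den : ℚ) = α := Rat.num_div_den α
  have hαz : (α : ZMod p) = ((α.num : ℤ) : ZMod p) / ((α.den : ℕ) : ZMod p) := by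
    rw [Rat.cast_def]
  have hb1 : α.num.natAbs ≤ max α.num.natAbs α.den := le_max_left _ _
  have hb2 : α.den ≤ max α.num.natAbs α.den := le_max_right _ _
  rcases Int.eq_nat_or_neg e with ⟨k, rfl | rfl⟩
  · refine ⟨α.num ^ k, (α.den : ℤ) ^ k, pow_ne_zero _ hden0, ?_, ?_, ?_, ?_, ?_⟩
    · intro h
      exact hd (Int.natCast_dvd_natCast.mp (hpp.dvd_of_dvd_pow h))
    · rw [zpow_natCast]
      calc α ^ k = ((α.num : ℚ) / (α.den : ℚ)) ^ k := by rw [hαq]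
        _ = ((α.num ^ k : ℤ) : ℚ) / (((α.den : ℤ) ^ k : ℤ) : ℚ) := by
          rw [div_pow]; push_cast; ring
    · rw [zpow_natCast, hαz, div_pow]; push_cast; rfl
    · rw [Int.natAbs_pow, Int.natAbs_natCast]; exact Nat.pow_le_pow_left hb1 k
    · rw [Int.natAbs_pow, Int.natAbs_natCast, Int.natAbs_natCast]
      exact Nat.pow_le_pow_left hb2 k
  · refine ⟨(α.den : ℤ) ^ k, α.num ^ k, pow_ne_zero _ hnum0, ?_, ?_, ?_, ?_, ?_⟩
    · intro h; exact hn (hpp.dvd_of_dvd_pow h)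
    · rw [zpow_neg, zpow_natCast]
      calc (α ^ k)⁻¹ = (((α.num : ℚ) / (α.den : ℚ)) ^ k)⁻¹ := by rw [hαq]
        _ = ((((α.den : ℤ) ^ k : ℤ)) : ℚ) / ((α.num ^ k : ℤ) : ℚ) := by
          rw [div_pow, inv_div]; push_cast; ring
    · rw [zpow_neg, zpow_natCast, hαz, div_pow, inv_div]; push_cast; rfl
    · rw [Int.natAbs_pow, Int.natAbs_natCast, Int.natAbs_neg, Int.natAbs_natCast]
      exact Nat.pow_le_pow_left hb2 k
    · rw [Int.natAbs_pow, Int.natAbs_neg, Int.natAbs_natCast]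
      exact Nat.pow_le_pow_left hb1 k

/-- **Liouville inequality for relations.**  If `α₁, α₂ ∈ ℚˣ` are multiplicatively independent
`p`-units and `ᾱ₁^m ᾱ₂^n = 1` in `𝔽_p` with `(m, n) ≠ (0, 0)`, then
`log p - log 2 ≤ |m| log H(α₁) + |n| log H(α₂)`. [folklore; paper §2.2(i)] -/
theorem soloInformed_liouville_relation (α₁ α₂ : ℚ) (hα₁ : α₁ ≠ 0) (hα₂ : α₂ ≠ 0)
    (hv₁ : padicValRat p α₁ = 0) (hv₂ : padicValRat p α₂ = 0)
    (hind : ∀ m n : ℤ, α₁ ^ m * α₂ ^ n = 1 → m = 0 ∧ n = 0)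
    (m n : ℤ) (hmn : ¬ (m = 0 ∧ n = 0))
    (hrel : (α₁ : ZMod p) ^ m * (α₂ : ZMod p) ^ n = 1) :
    Real.log p - Real.log 2 ≤ |(m : ℝ)| * Real.log (max (α₁.num.natAbs : ℝ) (α₁.den : ℝ))
      + |(n : ℝ)| * Real.log (max (α₂.num.natAbs : ℝ) (α₂.den : ℝ)) := by
  obtain ⟨U₁, V₁, hV₁, hpV₁, hq₁, hz₁, hU₁b, hV₁b⟩ := soloInformed_punit_zpow_repr α₁ hα₁ hv₁ m
  obtain ⟨U₂, V₂, hV₂, hpV₂, hq₂, hz₂, hU₂b, hV₂b⟩ := soloInformed_punit_zpow_repr α₂ hα₂ hv₂ n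
  set H₁ : ℕ := max α₁.num.natAbs α₁.den with hH₁def
  set H₂ : ℕ := max α₂.num.natAbs α₂.den with hH₂def
  have hH₁ : (H₁ : ℝ) = max (α₁.num.natAbs : ℝ) (α₁.den : ℝ) := by
    rw [hH₁def]; push_cast; rfl
  have hH₂ : (H₂ : ℝ) = max (α₂.num.natAbs : ℝ) (α₂.den : ℝ) := by
    rw [hH₂def]; push_cast; rfl
  have hH₁pos : 0 < H₁ := lt_of_lt_of_le α₁.den_pos (le_max_right _ _)
  have hH₂pos : 0 < H₂ := lt_of_lt_of_le α₂.den_pos (le_max_right _ _)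
  have hpp : p.Prime := hp.out
  -- the integer `U₁ U₂ - V₁ V₂` is a non-zero multiple of `p`
  have hV₁z : (V₁ : ZMod p) ≠ 0 := fun h => hpV₁ ((ZMod.intCast_zmod_eq_zero_iff_dvd V₁ p).mp h)
  have hV₂z : (V₂ : ZMod p) ≠ 0 := fun h => hpV₂ ((ZMod.intCast_zmod_eq_zero_iff_dvd V₂ p).mp h)
  have hDz : ((U₁ * U₂ - V₁ * V₂ : ℤ) : ZMod p) = 0 := by
    rw [hz₁, hz₂] at hrel
    field_simp at hrel
    push_cast
    linear_combination hrel
  have hpD : (p : ℤ) ∣ U₁ * U₂ - V₁ * V₂ := (ZMod.intCast_zmod_eq_zero_iff_dvd _ p).mp hDz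
  have hD0 : U₁ * U₂ - V₁ * V₂ ≠ 0 := by
    intro hD
    have hone : α₁ ^ m * α₂ ^ n = 1 := by
      rw [hq₁, hq₂]
      have hV₁q : (V₁ : ℚ) ≠ 0 := by exact_mod_cast hV₁
      have hV₂q : (V₂ : ℚ) ≠ 0 := by exact_mod_cast hV₂
      rw [div_mul_div_comm, div_eq_one_iff_eq (mul_ne_zero hV₁q hV₂q)]
      exact_mod_cast (sub_eq_zero.mp hD)
    obtain ⟨rfl, rfl⟩ := hind m n hone
    exact hmn ⟨rfl, rfl⟩
  -- size
  have hple : (p : ℤ) ≤ |U₁ * U₂ - V₁ * V₂| :=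
    Int.le_of_dvd (abs_pos.mpr hD0) ((dvd_abs _ _).mpr hpD)
  have hbound : |U₁ * U₂ - V₁ * V₂| ≤ 2 * ((H₁ : ℤ) ^ m.natAbs * (H₂ : ℤ) ^ n.natAbs) := by
    have a1 : |U₁| ≤ (H₁ : ℤ) ^ m.natAbs := by rw [Int.abs_eq_natAbs]; exact_mod_cast hU₁b
    have a2 : |U₂| ≤ (H₂ : ℤ) ^ n.natAbs := by rw [Int.abs_eq_natAbs]; exact_mod_cast hU₂b
    have a3 : |V₁| ≤ (H₁ : ℤ) ^ m.natAbs := by rw [Int.abs_eq_natAbs]; exact_mod_cast hV₁b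
    have a4 : |V₂| ≤ (H₂ : ℤ) ^ n.natAbs := by rw [Int.abs_eq_natAbs]; exact_mod_cast hV₂b
    have t : |U₁ * U₂ - V₁ * V₂| ≤ |U₁ * U₂| + |V₁ * V₂| := by
      have := abs_add_le (U₁ * U₂) (-(V₁ * V₂))
      rwa [abs_neg, ← sub_eq_add_neg] at this
    calc |U₁ * U₂ - V₁ * V₂| ≤ |U₁ * U₂| + |V₁ * V₂| := t
      _ = |U₁| * |U₂| + |V₁| * |V₂| := by rw [abs_mul, abs_mul]
      _ ≤ (H₁ : ℤ) ^ m.natAbs * (H₂ : ℤ) ^ n.natAbs + (H₁ : ℤ) ^ m.natAbs * (H₂ : ℤ) ^ n.natAbs :=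
          add_le_add (mul_le_mul a1 a2 (abs_nonneg _) (by positivity))
            (mul_le_mul a3 a4 (abs_nonneg _) (by positivity))
      _ = 2 * ((H₁ : ℤ) ^ m.natAbs * (H₂ : ℤ) ^ n.natAbs) := by ring
  have hpr : (p : ℝ) ≤ 2 * ((H₁ : ℝ) ^ m.natAbs * (H₂ : ℝ) ^ n.natAbs) := by
    have := le_trans hple hbound
    exact_mod_cast this
  have hH₁r : 0 < (H₁ : ℝ) := by exact_mod_cast hH₁pos
  have hH₂r : 0 < (H₂ : ℝ) := by exact_mod_cast hH₂pos
  have hp0 : (0 : ℝ) < p := by exact_mod_cast hpp.pos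
  have hlog := Real.log_le_log hp0 hpr
  rw [Real.log_mul (by norm_num) (by positivity), Real.log_mul (by positivity) (by positivity),
    Real.log_pow, Real.log_pow] at hlog
  rw [← hH₁, ← hH₂]
  have e1 : (m.natAbs : ℝ) = |(m : ℝ)| := by
    rw [Nat.cast_natAbs]; push_cast; rfl
  have e2 : (n.natAbs : ℝ) = |(n : ℝ)| := by
    rw [Nat.cast_natAbs]; push_cast; rfl
  rw [← e1, ← e2]
  linarith

end PUnits

/-- The elementary optimisation behind Theorem E: real variables, `K ≥ 3`, `L ≥ 2`. -/
theorem soloInformed_floor_endgame {K L W lam P T : ℝ} (hK : 3 ≤ K) (hL : 2 ≤ L)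
    (hW : 0 < W) (hlam : 0 < lam) (hPlam : 12 * P ≤ 13 * lam) (hT0 : 0 ≤ T)
    (hT : L * T < 2 * K * (L - 1) * P)
    (hstar : (K - 1) * L * W * lam ≤ 2 * T ^ 2 * lam + T * W) :
    W < 10 * K * P ^ 2 := by
  have hL0 : 0 < L := by linarith
  have hK0 : 0 < K := by linarith
  have hKL1 : 0 ≤ K * (L - 1) := by nlinarith
  have hP0 : 0 < P := by
    by_contra h
    push Not at h
    have h1 : 2 * K * (L - 1) * P ≤ 0 := by nlinarith
    have h2 : 0 ≤ L * T := by positivity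
    linarith
  set T₀ := 2 * K * (L - 1) * P / L with hT₀
  have hT₀L : T₀ * L = 2 * K * (L - 1) * P := by rw [hT₀]; field_simp
  have hTT₀ : T ≤ T₀ := by
    rw [hT₀, le_div_iff₀ hL0]; linarith
  have hT₀0 : 0 ≤ T₀ := le_trans hT0 hTT₀
  have h1 : 2 * T ^ 2 * lam + T * W ≤ 2 * T₀ ^ 2 * lam + T₀ * W := by
    have : T ^ 2 ≤ T₀ ^ 2 := pow_le_pow_left₀ hT0 hTT₀ 2
    nlinarith
  have hpoly : 0 ≤ 21 * K * L ^ 2 - 24 * L ^ 2 - 52 * K * L + 52 * K := by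
    have q1 : 0 ≤ 21 * L ^ 2 - 52 * L + 52 := by nlinarith [sq_nonneg (21 * L - 26)]
    have q2 := mul_nonneg (sub_nonneg.mpr hK) q1
    nlinarith [sq_nonneg (L - 2)]
  -- `8 T₀ ≤ lam · L · (7K - 8)`
  have h2 : 8 * T₀ ≤ lam * L * (7 * K - 8) := by
    have e1 : 8 * T₀ * L = 16 * K * (L - 1) * P := by
      rw [mul_assoc, hT₀L]; ring
    have e2 : 16 * K * (L - 1) * P ≤ 16 * K * (L - 1) * (13 * lam / 12) :=
      mul_le_mul_of_nonneg_left (by linarith) (by nlinarith)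
    have e3 : 52 * K * (L - 1) ≤ 3 * (L ^ 2 * (7 * K - 8)) := by nlinarith [hpoly]
    have e4 : 16 * K * (L - 1) * (13 * lam / 12) ≤ (lam * L * (7 * K - 8)) * L := by
      have := mul_le_mul_of_nonneg_left e3 hlam.le
      nlinarith [this]
    have e5 : 8 * T₀ * L ≤ (lam * L * (7 * K - 8)) * L := by linarith
    exact le_of_mul_le_mul_right e5 hL0
  have h3 : (K * L * W) * lam ≤ (16 * T₀ ^ 2) * lam := by
    have := mul_le_mul_of_nonneg_right h2 hW.le
    nlinarith [hstar, h1, this]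
  have h4 : K * L * W ≤ 16 * T₀ ^ 2 := le_of_mul_le_mul_right h3 hlam
  have h5 : K * L ^ 3 * W ≤ 64 * K ^ 2 * (L - 1) ^ 2 * P ^ 2 := by
    have e6 := mul_le_mul_of_nonneg_right h4 (by positivity : (0 : ℝ) ≤ L ^ 2)
    have e7 : 16 * T₀ ^ 2 * L ^ 2 = 64 * K ^ 2 * (L - 1) ^ 2 * P ^ 2 := by
      calc 16 * T₀ ^ 2 * L ^ 2 = 16 * (T₀ * L) ^ 2 := by ring
        _ = 16 * (2 * K * (L - 1) * P) ^ 2 := by rw [hT₀L]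
        _ = 64 * K ^ 2 * (L - 1) ^ 2 * P ^ 2 := by ring
    calc K * L ^ 3 * W = K * L * W * L ^ 2 := by ring
      _ ≤ 16 * T₀ ^ 2 * L ^ 2 := e6
      _ = 64 * K ^ 2 * (L - 1) ^ 2 * P ^ 2 := e7
  have h6 : 27 * (L - 1) ^ 2 ≤ 4 * L ^ 3 := by
    have := mul_nonneg (sq_nonneg (L - 3)) (by linarith : (0 : ℝ) ≤ 4 * L - 3)
    nlinarith [this]
  have h7 : 27 * (K * L ^ 3 * W) ≤ 256 * K ^ 2 * P ^ 2 * L ^ 3 := by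
    have := mul_le_mul_of_nonneg_left h6 (by positivity : (0 : ℝ) ≤ 64 * K ^ 2 * P ^ 2)
    nlinarith [h5, this]
  have h8 : 27 * W ≤ 256 * K * P ^ 2 := by
    have hKL3 : 0 < K * L ^ 3 := by positivity
    have : (27 * W) * (K * L ^ 3) ≤ (256 * K * P ^ 2) * (K * L ^ 3) := by nlinarith [h7]
    exact le_of_mul_le_mul_right this hKL3
  have h9 : 0 < K * P ^ 2 := by positivity
  nlinarith [h8, h9]

end Summit.ABC.ABC.Theorems
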